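import Literature.MathematicalPhysics.QuantumLattice.GrassmannQuarticWick
import Literature.MathematicalPhysics.QuantumLattice.HubbardGridFieldSubstitution
import Literature.MathematicalPhysics.QuantumLattice.GrassmannTruncatedSpectators
import HarnessLib

/-!
# The tracked part of the multiscale flow on the time grid: the local quartic flows only by tadpoles

Topic `MathematicalPhysics/QuantumLattice`; the hypothesis `hLflow` of `GrassmannFlowDB(Refined).iterEffAction_splitFlow_…` for the
Hubbard torus on the grid `{jβ/N} × (ℤ/L)²` (cell gate-hubbard-kl, R0-SCOPE-4 W5).  For a covariance `C` of the grid legs that pairs only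
`ψ⁺` with `ψ⁻` of the SAME spin (`contr C X Y = 0` for equal charges or different spins — every pulled-back normal covariance) and whose
equal-point tadpole `contr C ((q,σ),+) ((q,σ),-) = t` is the same for all points and both spins (translation and spin invariance), the
Gaussian convolution of the local quartic word is

`μ_C ⋆ (ψ⁺↑ψ⁻↑ψ⁺↓ψ⁻↓)(q) = (ψ⁺↑ψ⁻↑ψ⁺↓ψ⁻↓)(q) + t (ψ⁺↑ψ⁻↑ + ψ⁺↓ψ⁻↓)(q) + t²`   (`gaussConv_gridWord`),

so that the two-parameter family `u·V₁ + ν·N₂` (`V₁ = hubbardGridInteraction β 1`, `N₂ = hubbardGridQuadratic β`, `u, ν ∈ ℂ` — complex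
coupling) is mapped into itself up to constants: `μ_C ⋆ (uV₁ + νN₂) = uV₁ + (ν + u t)N₂ + const` (**`gaussConv_gridTracked`**), and its
positive-degree kernels flow by `ν ↦ ν + u t` (**`kernel_gaussConv_gridTracked`**) — Benfatto–Giuliani–Mastropietro 2006, (2.86)–(2.88)
(the beta function of the local part at lowest order is the tadpole), Salmhofer 1999 §4.3.  Also: `gridTracked_mem_evenPart`,
`constPart_gridTracked`, and the tadpole of a pulled-back normal covariance `contr (SᵀCS)((q,σ),+)((q,σ),-) = -(βL²)⁻² Σ_k p(k,σ)`
(`contr_gridSub_pullback_samePoint`).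

Everything is proved; `gridTracked` is the only definition; no named facts.

## Sources

G. Benfatto, A. Giuliani, V. Mastropietro, Ann. Henri Poincaré 7 (2006) 809–898, (2.86)–(2.88) (`BenfattoGiulianiMastropietro2006`);
M. Salmhofer, *Renormalization* (1999), §4.3 (4.38)–(4.44) (`Salmhofer1999`).
-/

noncomputable section

namespace Literature.MathematicalPhysics.QuantumLattice

open Literature.Probability.LatticeModels GrassmannAlgebra Finset

variable {L N : ℕ} [NeZero L]

/-! ### The Wick rule for the grid word under a charged, spin-diagonal covariance -/

/-- **The local quartic word convolves to itself plus tadpoles**: if `contr C` vanishes between equal charges and between different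
spins, then `μ_C ⋆ word(q) = word(q) + contr((q,↓,+),(q,↓,-))·ψ⁺↑ψ⁻↑(q) + contr((q,↑,+),(q,↑,-))·ψ⁺↓ψ⁻↓(q) + (product of the two)`.
[cite: BenfattoGiulianiMastropietro2006, (2.86)-(2.88)] -/
theorem gaussConv_gridWord (C : Matrix (GridLeg (GridPoint L N)) (GridLeg (GridPoint L N)) ℂ)
    (hcharge : ∀ X Y : GridLeg (GridPoint L N), X.2 = Y.2 → contr ℂ C X Y = 0)
    (hspin : ∀ X Y : GridLeg (GridPoint L N), X.1.2 ≠ Y.1.2 → contr ℂ C X Y = 0) (q : GridPoint L N) :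
    gaussConv ℂ C (gridWord L N q) =
      gridWord L N q +
        (contr ℂ C (((q, 1), 0) : GridLeg (GridPoint L N)) ((q, 1), 1) •
            (gen ℂ (((q, 0), 0) : GridLeg (GridPoint L N)) * gen ℂ (((q, 0), 1) : GridLeg (GridPoint L N))) +
          contr ℂ C (((q, 0), 0) : GridLeg (GridPoint L N)) ((q, 0), 1) •
            (gen ℂ (((q, 1), 0) : GridLeg (GridPoint L N)) * gen ℂ (((q, 1), 1) : GridLeg (GridPoint L N)))) +
        algebraMap ℂ _ (contr ℂ C (((q, 0), 0) : GridLeg (GridPoint L N)) ((q, 0), 1) *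
          contr ℂ C (((q, 1), 0) : GridLeg (GridPoint L N)) ((q, 1), 1)) := by
  rw [gridWord, gaussConv_gen_four]
  have h1 : contr ℂ C (((q, 0), 1) : GridLeg (GridPoint L N)) ((q, 1), 1) = 0 := hcharge _ _ rfl
  have h2 : contr ℂ C (((q, 0), 1) : GridLeg (GridPoint L N)) ((q, 1), 0) = 0 := hspin _ _ (by simp)
  have h3 : contr ℂ C (((q, 0), 0) : GridLeg (GridPoint L N)) ((q, 1), 0) = 0 := hcharge _ _ rfl
  have h4 : contr ℂ C (((q, 0), 0) : GridLeg (GridPoint L N)) ((q, 1), 1) = 0 := hspin _ _ (by simp)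
  rw [h1, h2, h3, h4]
  simp only [zero_smul, sub_zero, add_zero, mul_zero]

/-! ### The tracked two-parameter family -/

variable (L N) in
/-- The **tracked local part** `u·V₁ + ν·N₂` of the effective action on the grid (complex coupling `u`, chemical-potential counterterm
`ν`; `V₁ = hubbardGridInteraction β 1`, `N₂ = hubbardGridQuadratic β`). [cite: BenfattoGiulianiMastropietro2006, (2.86)-(2.88)] -/
def gridTracked (β : ℝ) (u ν : ℂ) : GrassmannAlgebra ℂ (GridLeg (GridPoint L N)) :=
  u • hubbardGridInteraction L N β 1 + ν • hubbardGridQuadratic L N β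

/-- The tracked part is even. [cite: BenfattoGiulianiMastropietro2006, (2.86)-(2.88)] -/
theorem gridTracked_mem_evenPart (β : ℝ) (u ν : ℂ) : gridTracked L N β u ν ∈ evenPart ℂ (GridLeg (GridPoint L N)) := by
  unfold gridTracked hubbardGridInteraction hubbardGridQuadratic gridWord
  refine Subalgebra.add_mem _ (Subalgebra.smul_mem _ (Subalgebra.smul_mem _ (Subalgebra.sum_mem _ fun q _ => ?_) _) _)
    (Subalgebra.smul_mem _ (Subalgebra.smul_mem _ (Subalgebra.sum_mem _ fun q _ => Subalgebra.sum_mem _ fun σ _ => ?_) _) _)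
  · rw [mem_evenPart_iff, mul_assoc]
    exact mul_mem_evenOdd_zero ℂ (gen_mul_gen_mem_evenOdd_zero ℂ _ _) (gen_mul_gen_mem_evenOdd_zero ℂ _ _)
  · exact (mem_evenPart_iff).2 (gen_mul_gen_mem_evenOdd_zero ℂ _ _)

/-- The tracked part has no constant part. [cite: BenfattoGiulianiMastropietro2006, (2.86)-(2.88)] -/
theorem constPart_gridTracked (β : ℝ) (u ν : ℂ) : constPart ℂ (gridTracked L N β u ν) = 0 := by
  simp [gridTracked, constPart_hubbardGridInteraction, constPart_hubbardGridQuadratic]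

/-- **The tracked family is stable under Gaussian convolution up to constants**: under the hypotheses of `gaussConv_gridWord` and a
point- and spin-independent tadpole `contr C ((q,σ),+) ((q,σ),-) = t`,
`μ_C ⋆ (uV₁ + νN₂) = uV₁ + (ν + u t)N₂ + (β/N)·(u t² + 2ν t)·#points`. [cite: BenfattoGiulianiMastropietro2006, (2.86)-(2.88)] -/
theorem gaussConv_gridTracked [NeZero N] (C : Matrix (GridLeg (GridPoint L N)) (GridLeg (GridPoint L N)) ℂ)
    (hcharge : ∀ X Y : GridLeg (GridPoint L N), X.2 = Y.2 → contr ℂ C X Y = 0)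
    (hspin : ∀ X Y : GridLeg (GridPoint L N), X.1.2 ≠ Y.1.2 → contr ℂ C X Y = 0) {t : ℂ}
    (ht : ∀ (q : GridPoint L N) (σ : Fin 2), contr ℂ C (((q, σ), 0) : GridLeg (GridPoint L N)) ((q, σ), 1) = t)
    (β : ℝ) (u ν : ℂ) :
    gaussConv ℂ C (gridTracked L N β u ν) =
      gridTracked L N β u (ν + u * t) +
        algebraMap ℂ _ ((((β / N) : ℝ) : ℂ) * (Fintype.card (GridPoint L N) : ℂ) * (u * (t * t) + ν * (2 * t))) := by
  have hword : ∀ q : GridPoint L N, gaussConv ℂ C (gridWord L N q) =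
      gridWord L N q + t • (∑ σ : Fin 2, gen ℂ (((q, σ), 0) : GridLeg (GridPoint L N)) * gen ℂ (((q, σ), 1) : GridLeg (GridPoint L N))) +
        algebraMap ℂ _ (t * t) := by
    intro q
    rw [gaussConv_gridWord C hcharge hspin q, ht q 0, ht q 1, Fin.sum_univ_two, smul_add]
  have hpair : ∀ (q : GridPoint L N) (σ : Fin 2),
      gaussConv ℂ C (gen ℂ (((q, σ), 0) : GridLeg (GridPoint L N)) * gen ℂ (((q, σ), 1) : GridLeg (GridPoint L N))) =
        gen ℂ (((q, σ), 0) : GridLeg (GridPoint L N)) * gen ℂ (((q, σ), 1) : GridLeg (GridPoint L N)) + algebraMap ℂ _ t := by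
    intro q σ
    rw [gaussConv_gen_mul_gen, ← contr_apply, ht q σ]
  -- closed forms for the two generators of the family
  set S₂ : GrassmannAlgebra ℂ (GridLeg (GridPoint L N)) :=
    ∑ q : GridPoint L N, ∑ σ : Fin 2, gen ℂ (((q, σ), 0) : GridLeg (GridPoint L N)) * gen ℂ (((q, σ), 1) : GridLeg (GridPoint L N))
    with hS₂
  have hV : gaussConv ℂ C (hubbardGridInteraction L N β 1) =
      hubbardGridInteraction L N β 1 + ((((β / N) : ℝ) : ℂ) * t) • S₂ +
        ((((β / N) : ℝ) : ℂ) * (Fintype.card (GridPoint L N) : ℂ) * (t * t)) • (1 : GrassmannAlgebra ℂ (GridLeg (GridPoint L N))) := by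
    unfold hubbardGridInteraction
    rw [map_smul, map_sum]
    simp only [hword, sum_add_distrib, ← Finset.smul_sum, sum_const, card_univ, Algebra.algebraMap_eq_smul_one, smul_add,
      smul_smul, ← hS₂, ← Nat.cast_smul_eq_nsmul ℂ]
    push_cast
    simp only [one_mul]
    congr 2
    ring
  have hN : gaussConv ℂ C (hubbardGridQuadratic L N β) =
      hubbardGridQuadratic L N β +
        ((((β / N) : ℝ) : ℂ) * ((Fintype.card (GridPoint L N) : ℂ) * 2) * t) • (1 : GrassmannAlgebra ℂ (GridLeg (GridPoint L N))) := by
    unfold hubbardGridQuadratic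
    rw [map_smul, map_sum]
    simp only [map_sum, hpair, sum_add_distrib, sum_const, card_univ, Fintype.card_fin, Algebra.algebraMap_eq_smul_one, smul_add,
      smul_smul, ← hS₂, ← Nat.cast_smul_eq_nsmul ℂ]
    congr 1
    push_cast
    congr 1
    ring
  rw [gridTracked, gridTracked, map_add, map_smul, map_smul, hV, hN]
  unfold hubbardGridQuadratic
  rw [← hS₂, Algebra.algebraMap_eq_smul_one]
  simp only [smul_add, smul_smul]
  module

/-- **The positive-degree kernels of the tracked part flow by the tadpole**: `kernel (μ_C ⋆ (uV₁+νN₂)) m = kernel (uV₁ + (ν+ut)N₂) m`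
for `m ≥ 1` — the hypothesis `hLflow` of the split flow. [cite: BenfattoGiulianiMastropietro2006, (2.86)-(2.88)] -/
theorem kernel_gaussConv_gridTracked [NeZero N] (C : Matrix (GridLeg (GridPoint L N)) (GridLeg (GridPoint L N)) ℂ)
    (hcharge : ∀ X Y : GridLeg (GridPoint L N), X.2 = Y.2 → contr ℂ C X Y = 0)
    (hspin : ∀ X Y : GridLeg (GridPoint L N), X.1.2 ≠ Y.1.2 → contr ℂ C X Y = 0) {t : ℂ}
    (ht : ∀ (q : GridPoint L N) (σ : Fin 2), contr ℂ C (((q, σ), 0) : GridLeg (GridPoint L N)) ((q, σ), 1) = t)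
    (β : ℝ) (u ν : ℂ) {m : ℕ} (hm : 0 < m) (Y : Fin m → GridLeg (GridPoint L N)) :
    kernel ℂ (gaussConv ℂ C (gridTracked L N β u ν)) m Y = kernel ℂ (gridTracked L N β u (ν + u * t)) m Y := by
  obtain ⟨m, rfl⟩ := Nat.exists_eq_succ_of_ne_zero hm.ne'
  rw [gaussConv_gridTracked C hcharge hspin ht, kernel_add, kernel_algebraMap_succ, add_zero]

/-! ### The tadpole of a pulled-back normal covariance -/

/-- **The equal-point contraction of a pulled-back normal covariance** is the momentum average of its symbol:
`contr (Sᵀ C_p S)((q,σ),+)((q,σ),-) = -(βL²)⁻² Σ_k p(k,σ)` — the same for every grid point (translation invariance).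
[cite: BenfattoGiulianiMastropietro2006, §2.1 (2.3)] -/
theorem contr_gridSub_pullback_samePoint {M : ℕ} {P : Type*} [Fintype P] [DecidableEq P] (β : ℝ) (x : P → TorusSite 2 L)
    (τ : P → ℝ) (p : FreqMomentum L M × Fin 2 → ℂ) (q : P) (σ : Fin 2) :
    contr ℂ ((gridSubMatrix L M β x τ).transpose * normalCovariance L M p * gridSubMatrix L M β x τ)
        (((q, σ), 0) : GridLeg P) ((q, σ), 1) =
      -∑ k : FreqMomentum L M, ((1 / (β * (L : ℝ) ^ 2) : ℝ) : ℂ) ^ 2 * p (k, σ) := by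
  set C' := (gridSubMatrix L M β x τ).transpose * normalCovariance L M p * gridSubMatrix L M β x τ with hC'
  have hanti : C' (((q, σ), 1) : GridLeg P) ((q, σ), 0) = -C' ((q, σ), 0) ((q, σ), 1) := by
    have h := congrFun (congrFun (gridSub_pullback_normalCovariance_transpose β x τ p) ((q, σ), 0)) ((q, σ), 1)
    rw [Matrix.transpose_apply, Matrix.neg_apply, ← hC'] at h
    exact h
  rw [contr_apply, hanti, show ((1 / 2 : ℚ) • (1 : ℂ)) * (-C' ((q, σ), 0) ((q, σ), 1) - C' ((q, σ), 0) ((q, σ), 1)) =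
    -C' ((q, σ), 0) ((q, σ), 1) by rw [Rat.smul_one_eq_cast]; push_cast; ring]
  rw [hC', gridSub_pullback_normalCovariance_apply_zero_one, if_pos rfl]
  congr 1
  refine sum_congr rfl fun k _ => ?_
  rw [sub_self, Complex.ofReal_zero, zero_mul, Complex.exp_zero, one_mul]

end Literature.MathematicalPhysics.QuantumLattice

end
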